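import Mathlib
import HarnessLib

/-!
# Hilbert–Siegel modular forms of genus 2: level `Γ₀(𝔫)`, `q`-expansions, `R`-valued (mod `N`)
# forms and the Hecke operators `T(ϖ)` on `q`-expansions

Requested by route `Langlands/TorsionKudlaMillson` (item `defn-HilbertSiegelModularFormModN`): an
ALGEBRAIC (i.e. `q`-expansion) notion of Hilbert–Siegel modular forms of genus `2` and parallel
weight `k` with coefficients in an arbitrary commutative ring `R` (typically `R = ℤ/N`), together
with the classical action of the Hecke operators on Fourier coefficients, so that one can STATE
"a given formal series `∑_T c(T) q^T` with `c(T) ∈ R` is the `q`-expansion of a mod-`N`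
Hilbert–Siegel modular form, Hecke-equivariantly".

Throughout `F` is a number field (intended totally real; for `F = ℚ` everything below is the
classical genus-`2` Siegel picture, the real embeddings `F →+* ℝ` being a singleton), `𝓞 F` its
ring of integers, and `Sp4 (𝓞 F) = Matrix.symplecticGroup (Fin 2) (𝓞 F)` Mathlib's symplectic
group `{γ | γ J γᵀ = J}` in `2 × 2` block form `γ = (A B; C D)`.

## Contents

* §1 Level structure (any commutative ring `R`): `HilbertSiegel.Gamma0 𝔫 ≤ Sp4 R`, the subgroup
  `C ≡ 0 (mod 𝔫)` [Andrianov2009, (2.2)], and for a multiplicative character `ψ` of `R ⧸ 𝔫` the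
  character `γ ↦ ψ(det D mod 𝔫)` of `Γ₀(𝔫)` [Andrianov2009, (2.3) and Lemma 4.11], proved
  multiplicative here (`Gamma0.character`).
* §2 The analytic objects: the Siegel upper half space `siegelUpperHalfSpace n` [Andrianov2009,
  (1.5)], the Hilbert–Siegel half space `ℍ₂^{Hom(F,ℝ)}` [Sankaran2025, §2.1], the action
  `Z ↦ (AZ+B)(CZ+D)⁻¹` and automorphy factor `∏_σ det(C^σ Z_σ + D^σ)` [Andrianov2009, (1.6),
  (1.29)], and the `ℂ`-vector space `HilbertSiegel.modularForms Γ χ k` of holomorphic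
  `f : ℍ → ℂ` with `f(γZ) = χ(γ) j(γ,Z)^k f(Z)` for `γ ∈ Γ` [Andrianov2009, §1.3 (1.32)]
  (parallel weight `k`, level any subgroup `Γ ≤ Sp4 (𝓞 F)`, character any `χ : Γ →* ℂ`).
* §3 `q`-expansions: the index set `qIndexSet F` of symmetric `T ∈ M₂(F)` that pair integrally
  with `Sym₂(𝓞 F)` under `(T,S) ↦ Tr_{F/ℚ} tr(TS)` (= "half-integral": `t₁₁, t₂₂, 2t₁₂ ∈ 𝔡⁻¹`)
  and are totally positive semi-definite (Koecher), the Fourier coefficient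
  `a(T) = ∫_{X mod Sym₂(𝓞 F)} f(X + i·1) e^{-2πi⟨T, X + i·1⟩} dX` [vanderGeer2008, §4] and
  `qExpansion f : Matrix (Fin 2) (Fin 2) F → ℂ` (extended by `0` off the index set).
* §4 THE REQUESTED NOTION: the `R`-submodule `hilbertSiegelModularFormModN Γ χ k R` of formal
  `q`-series `Matrix (Fin 2) (Fin 2) F → R` spanned by the coefficientwise images of the
  `q`-expansions WITH INTEGER COEFFICIENTS of forms in `modularForms Γ χ k` — i.e. the image of
  `M_k(Γ, χ; ℤ) ⊗_ℤ R` in `R⟦q⟧`, the "reduction mod `N`" integral structure defined through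
  `q`-expansions (the `q`-expansion principle, [FaltingsChai1990, Ch. V]) — and its type of
  elements `HilbertSiegelModularFormModN Γ χ k R`.
* §5 Hecke operators on formal `q`-series at a principal prime `(ϖ)`, `ϖ ≫ 0`, prime to the
  level, by the classical coset formula [Andrianov2009, Prop. 5.16 with `m = p`, left-coset
  representatives of Ex. 3.19], transcribed from `(ℤ, p)` to `(𝓞 F, ϖ)`:
  `(T(ϖ)a)(T) = a(ϖT) + χ(ϖ) q^{k-2} ∑_{D ∈ 𝓓(ϖ)} a(ϖ⁻¹ D T Dᵀ) + χ(ϖ)² q^{2k-3} a(ϖ⁻¹ T)`,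
  `𝓓(ϖ) = {(1 j; 0 ϖ) : j mod ϖ} ∪ {(ϖ 0; 0 1)}`, `q = N(ϖ)`, `a ≡ 0` off the index set.

## Design notes

* Holomorphy is Fréchet-differentiability over `ℂ` on the open set `ℍ` inside the `Pi` normed
  space `(F →+* ℝ) → Fin 2 → Fin 2 → ℂ` (transported along `Matrix.of`, so that only canonical
  instances occur). Forms are functions on all of `(F →+* ℝ) → Matrix (Fin 2) (Fin 2) ℂ` forced
  to vanish off `ℍ` (`IsModularForm.eq_zero`), so that `modularForms Γ χ k` is an honest
  `Submodule ℂ` isomorphic to the classical space. No condition at the cusps is imposed: in genus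
  `2` it is automatic (Koecher's principle, [vanderGeer2008, Thm. 2]; [Klingen1990, §4]).
* The Fourier coefficient is the integral over the unit cube in the coordinates of the integral
  basis `NumberField.integralBasis F` placed in the three slots of a symmetric `2 × 2` matrix, at
  imaginary part `1`; this cube is a fundamental parallelotope of `Sym₂(𝓞 F)` of volume `1`, so no
  normalising constant appears. It is meaningful for `Sym₂(𝓞 F)`-periodic `f`, i.e. for levels
  `Γ ⊇ {(1 S; 0 1) : S ∈ Sym₂(𝓞 F)}` with `χ` trivial on these translations — e.g. `Γ = Gamma0 𝔫`,
  `χ = Gamma0.character 𝔫 ψ` (`det D = 1` there).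
* `q`-series are plain functions `Matrix (Fin 2) (Fin 2) F → R`; `qSeries F R` is the submodule
  of those supported on `qIndexSet F`, and every construction below lands in it. A user's series
  `T ↦ c(T)` needs no membership proofs to be written down.
* The Hecke operator depends on the generator `ϖ` (only through `ϖ` mod squares of units on
  genuine `q`-expansions) and, on ARBITRARY functions, on the chosen transversal of `𝓞 F ⧸ (ϖ)`;
  `heckeTWith` takes the transversal as an argument (over `ℚ` use `{0,…,p-1}`), `heckeT` fixes one
  by choice. Weights `k < 2` give the junk exponents `k - 2 = 0`, `2k - 3 = 0` (ℕ-subtraction):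
  the classical operator is not integral there. `ϖ = 0` gives the empty transversal (junk).
* This file is FACT-FREE (no named `def … : Prop` hypotheses): the comparison theorems
  (`q`-expansion principle/injectivity, Koecher, stability of `hilbertSiegelModularFormModN`
  under `heckeT`, agreement of `heckeT` with the double-coset operator) are deliberately NOT
  stated here, so that importing routes keep a clean cone.

## What is not here

Vector-valued or non-parallel weights; genus `≠ 2` (except `siegelUpperHalfSpace n`); the
similitude group `GSp₄` and non-principal Hecke operators `T(𝔭)`; `T₁(ϖ²)`; cusp forms; the
Faltings–Chai moduli-theoretic `M_k(Γ; R) = H⁰(𝒜 ⊗ R, ω^k)` (which can be larger than the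
reduction of characteristic-`0` forms in low weight).
-/

open scoped Matrix ComplexConjugate

namespace Literature.NumberTheory.Automorphic

open _root_.MeasureTheory _root_.NumberField

/-! ## §1 Level structure in `Sp₄` over a commutative ring -/

namespace HilbertSiegel

section Level

variable {R : Type*} [CommRing R]

variable (R) in
/-- `Sp4 R`: Mathlib's symplectic group `Matrix.symplecticGroup (Fin 2) R` of `4 × 4` matrices
`γ` over `R` in `2 × 2` block form with `γ J γᵀ = J`, as a type (it is a group). [folklore] -/
abbrev Sp4 : Type _ := ↥(Matrix.symplecticGroup (Fin 2) R)

/-- The upper-left block `A` of `γ = (A B; C D) ∈ Sp₄(R)`. [folklore] -/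
def blockA (γ : Sp4 R) : Matrix (Fin 2) (Fin 2) R := (γ : Matrix (Fin 2 ⊕ Fin 2) (Fin 2 ⊕ Fin 2) R).toBlocks₁₁

/-- The upper-right block `B` of `γ = (A B; C D) ∈ Sp₄(R)`. [folklore] -/
def blockB (γ : Sp4 R) : Matrix (Fin 2) (Fin 2) R := (γ : Matrix (Fin 2 ⊕ Fin 2) (Fin 2 ⊕ Fin 2) R).toBlocks₁₂

/-- The lower-left block `C` of `γ = (A B; C D) ∈ Sp₄(R)`. [folklore] -/
def blockC (γ : Sp4 R) : Matrix (Fin 2) (Fin 2) R := (γ : Matrix (Fin 2 ⊕ Fin 2) (Fin 2 ⊕ Fin 2) R).toBlocks₂₁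

/-- The lower-right block `D` of `γ = (A B; C D) ∈ Sp₄(R)`. [folklore] -/
def blockD (γ : Sp4 R) : Matrix (Fin 2) (Fin 2) R := (γ : Matrix (Fin 2 ⊕ Fin 2) (Fin 2 ⊕ Fin 2) R).toBlocks₂₂

/-- Entries of the `C`-block. [folklore] -/
@[simp] theorem blockC_apply (γ : Sp4 R) (i j : Fin 2) :
    blockC γ i j = (γ : Matrix (Fin 2 ⊕ Fin 2) (Fin 2 ⊕ Fin 2) R) (Sum.inr i) (Sum.inl j) := rfl

/-- Entries of the `D`-block. [folklore] -/
@[simp] theorem blockD_apply (γ : Sp4 R) (i j : Fin 2) :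
    blockD γ i j = (γ : Matrix (Fin 2 ⊕ Fin 2) (Fin 2 ⊕ Fin 2) R) (Sum.inr i) (Sum.inr j) := rfl

/-- The `C`-block of `γ⁻¹` is `-Cᵀ` (from `γ⁻¹ = -J γᵀ J = (Dᵀ -Bᵀ; -Cᵀ Aᵀ)`). [folklore] -/
theorem blockC_inv (γ : Sp4 R) : blockC γ⁻¹ = -(blockC γ)ᵀ := by
  ext i j
  have h : ((γ⁻¹ : Sp4 R) : Matrix (Fin 2 ⊕ Fin 2) (Fin 2 ⊕ Fin 2) R) = -Matrix.J (Fin 2) R * (γ : Matrix (Fin 2 ⊕ Fin 2) (Fin 2 ⊕ Fin 2) R)ᵀ *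
      Matrix.J (Fin 2) R := SymplecticGroup.coe_inv γ
  rw [blockC_apply, h]
  conv_lhs => rw [← Matrix.fromBlocks_toBlocks (γ : Matrix (Fin 2 ⊕ Fin 2) (Fin 2 ⊕ Fin 2) R)]
  simp [Matrix.J, Matrix.fromBlocks_transpose, Matrix.fromBlocks_multiply,
    Matrix.fromBlocks_neg, blockC]

/-- The `C`-block of a product: `C_{γδ} = C_γ A_δ + D_γ C_δ`. [folklore] -/
theorem blockC_mul (γ δ : Sp4 R) : blockC (γ * δ) = blockC γ * blockA δ + blockD γ * blockC δ := by
  have h : ((γ * δ : Sp4 R) : Matrix (Fin 2 ⊕ Fin 2) (Fin 2 ⊕ Fin 2) R) = (γ : Matrix (Fin 2 ⊕ Fin 2) (Fin 2 ⊕ Fin 2) R) * (δ : Matrix (Fin 2 ⊕ Fin 2) (Fin 2 ⊕ Fin 2) R) := rfl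
  unfold blockC blockA blockD
  rw [h]
  conv_lhs => rw [← Matrix.fromBlocks_toBlocks (γ : Matrix (Fin 2 ⊕ Fin 2) (Fin 2 ⊕ Fin 2) R),
    ← Matrix.fromBlocks_toBlocks (δ : Matrix (Fin 2 ⊕ Fin 2) (Fin 2 ⊕ Fin 2) R), Matrix.fromBlocks_multiply]
  rw [Matrix.toBlocks_fromBlocks₂₁]

/-- The `D`-block of a product: `D_{γδ} = C_γ B_δ + D_γ D_δ`. [folklore] -/
theorem blockD_mul (γ δ : Sp4 R) : blockD (γ * δ) = blockC γ * blockB δ + blockD γ * blockD δ := by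
  have h : ((γ * δ : Sp4 R) : Matrix (Fin 2 ⊕ Fin 2) (Fin 2 ⊕ Fin 2) R) = (γ : Matrix (Fin 2 ⊕ Fin 2) (Fin 2 ⊕ Fin 2) R) * (δ : Matrix (Fin 2 ⊕ Fin 2) (Fin 2 ⊕ Fin 2) R) := rfl
  unfold blockC blockB blockD
  rw [h]
  conv_lhs => rw [← Matrix.fromBlocks_toBlocks (γ : Matrix (Fin 2 ⊕ Fin 2) (Fin 2 ⊕ Fin 2) R),
    ← Matrix.fromBlocks_toBlocks (δ : Matrix (Fin 2 ⊕ Fin 2) (Fin 2 ⊕ Fin 2) R), Matrix.fromBlocks_multiply]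
  rw [Matrix.toBlocks_fromBlocks₂₂]

/-- `C`-block of the identity. [folklore] -/
@[simp] theorem blockC_one : blockC (1 : Sp4 R) = 0 := by
  ext i j; simp

/-- `D`-block of the identity. [folklore] -/
@[simp] theorem blockD_one : blockD (1 : Sp4 R) = 1 := by
  ext i j; simp [Matrix.one_apply]

/-- The congruence subgroup `Γ₀(𝔫) = {(A B; C D) ∈ Sp₄(R) : C ≡ 0 (mod 𝔫)}` of level an ideal
`𝔫 ⊆ R` (for `R = ℤ`, `𝔫 = (q)` this is Andrianov's `Γ₀²(q)`). [cite: Andrianov2009, (2.2)] -/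
def Gamma0 (𝔫 : Ideal R) : Subgroup (Sp4 R) where
  carrier := {γ | ∀ i j, blockC γ i j ∈ 𝔫}
  one_mem' := by intro i j; simp
  mul_mem' := by
    intro γ δ hγ hδ i j
    rw [blockC_mul, Matrix.add_apply, Matrix.mul_apply, Matrix.mul_apply]
    exact 𝔫.add_mem (𝔫.sum_mem fun x _ => 𝔫.mul_mem_right _ (hγ i x))
      (𝔫.sum_mem fun x _ => 𝔫.mul_mem_left _ (hδ x j))
  inv_mem' := by
    intro γ hγ i j
    rw [blockC_inv, Matrix.neg_apply, Matrix.transpose_apply]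
    exact 𝔫.neg_mem (hγ j i)

/-- Membership in `Γ₀(𝔫)`: all entries of the `C`-block lie in `𝔫`. [cite: Andrianov2009, (2.2)] -/
theorem mem_Gamma0_iff {𝔫 : Ideal R} {γ : Sp4 R} : γ ∈ Gamma0 𝔫 ↔ ∀ i j, blockC γ i j ∈ 𝔫 :=
  Iff.rfl

/-- Level `1`: `Γ₀(R) = Sp₄(R)`. [folklore] -/
@[simp] theorem Gamma0_top : Gamma0 (⊤ : Ideal R) = ⊤ := by
  ext γ; simp [mem_Gamma0_iff]

/-- On `Γ₀(𝔫)` the reduction of the `D`-block is multiplicative: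
`D_{γδ} ≡ D_γ D_δ (mod 𝔫)` since `C_γ ≡ 0`. [folklore] -/
theorem blockD_mul_map_mk {𝔫 : Ideal R} {γ : Sp4 R} (hγ : γ ∈ Gamma0 𝔫) (δ : Sp4 R) :
    (Ideal.Quotient.mk 𝔫).mapMatrix (blockD (γ * δ)) =
      (Ideal.Quotient.mk 𝔫).mapMatrix (blockD γ) * (Ideal.Quotient.mk 𝔫).mapMatrix (blockD δ) := by
  have hC : (Ideal.Quotient.mk 𝔫).mapMatrix (blockC γ) = 0 := by
    ext i j; exact Ideal.Quotient.eq_zero_iff_mem.2 (hγ i j)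
  rw [blockD_mul, map_add, map_mul, map_mul, hC, zero_mul, zero_add]

/-- The character `γ = (A B; C D) ↦ ψ(det D mod 𝔫)` of `Γ₀(𝔫)` attached to a multiplicative
character `ψ` of `R ⧸ 𝔫` (a Dirichlet character mod `q` when `R = ℤ`), as a monoid homomorphism
`Γ₀(𝔫) →* S`. [cite: Andrianov2009, (2.3) and Lemma 4.11] -/
noncomputable def Gamma0.character (𝔫 : Ideal R) {S : Type*} [CommRing S]
    (ψ : MulChar (R ⧸ 𝔫) S) : Gamma0 𝔫 →* S where
  toFun γ := ψ (Ideal.Quotient.mk 𝔫 (blockD (γ : Sp4 R)).det)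
  map_one' := by simp
  map_mul' γ δ := by
    simp only [Subgroup.coe_mul]
    rw [← map_mul ψ, RingHom.map_det, RingHom.map_det, RingHom.map_det, blockD_mul_map_mk γ.2,
      Matrix.det_mul]

/-- Unfolding of `Gamma0.character`: `χ(γ) = ψ(det D_γ mod 𝔫)`. [cite: Andrianov2009, Lemma 4.11] -/
theorem Gamma0.character_apply (𝔫 : Ideal R) {S : Type*} [CommRing S] (ψ : MulChar (R ⧸ 𝔫) S)
    (γ : Gamma0 𝔫) :
    Gamma0.character 𝔫 ψ γ = ψ (Ideal.Quotient.mk 𝔫 (blockD (γ : Sp4 R)).det) := rfl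

end Level

end HilbertSiegel

/-! ## §2 The Siegel and Hilbert–Siegel upper half spaces; holomorphic modular forms -/

/-- The **Siegel upper half space** of degree `n`: complex symmetric `n × n` matrices
`Z = X + iY` with `Y` positive definite. [cite: Andrianov2009, (1.5)] -/
def siegelUpperHalfSpace (n : ℕ) : Set (Matrix (Fin n) (Fin n) ℂ) :=
  {Z | Z.IsSymm ∧ (Z.map Complex.im).PosDef}

/-- Membership in the Siegel upper half space. [cite: Andrianov2009, (1.5)] -/
theorem mem_siegelUpperHalfSpace_iff {n : ℕ} {Z : Matrix (Fin n) (Fin n) ℂ} :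
    Z ∈ siegelUpperHalfSpace n ↔ Z.IsSymm ∧ (Z.map Complex.im).PosDef :=
  Iff.rfl

namespace HilbertSiegel

variable (F : Type*) [Field F] [NumberField F]

/-- Points of the ambient space of the Hilbert–Siegel half space of genus `2` over `F`: one complex
`2 × 2` matrix `Z_σ` for each real embedding `σ : F →+* ℝ` (i.e. `M₂(F ⊗_ℚ ℂ)` for `F` totally
real, coordinatised by the embeddings). [cite: Sankaran2025, §2.1] -/
abbrev Point : Type _ := (F →+* ℝ) → Matrix (Fin 2) (Fin 2) ℂ

/-- The **Hilbert–Siegel upper half space** of genus `2` over `F`: `Z_σ ∈ ℍ₂` for every real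
embedding `σ`, i.e. `{u + iv ∈ Sym₂(F ⊗ ℝ) : v ≫ 0}`. [cite: Sankaran2025, §2.1] -/
def halfSpace : Set (Point F) :=
  {Z | ∀ σ, Z σ ∈ siegelUpperHalfSpace 2}

variable {F}

omit [NumberField F] in
/-- Membership in the Hilbert–Siegel half space. [cite: Sankaran2025, §2.1] -/
theorem mem_halfSpace_iff {Z : Point F} : Z ∈ halfSpace F ↔ ∀ σ, Z σ ∈ siegelUpperHalfSpace 2 :=
  Iff.rfl

/-- The complex embedding `𝓞 F → F →σ ℝ ⊆ ℂ` attached to a real embedding `σ`. [folklore] -/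
noncomputable def embC (σ : F →+* ℝ) : 𝓞 F →+* ℂ :=
  (Complex.ofRealHom.comp σ).comp (algebraMap (𝓞 F) F)

omit [NumberField F] in
/-- Unfolding of `embC`. [folklore] -/
@[simp] theorem embC_apply (σ : F →+* ℝ) (x : 𝓞 F) : embC σ x = ((σ (x : F) : ℝ) : ℂ) := rfl

/-- The image `M^σ ∈ M₂(ℂ)` of an integral matrix `M ∈ M₂(𝓞 F)` under the real embedding `σ`.
[folklore] -/
noncomputable def embMat (σ : F →+* ℝ) (M : Matrix (Fin 2) (Fin 2) (𝓞 F)) :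
    Matrix (Fin 2) (Fin 2) ℂ :=
  M.map (embC σ)

/-- The action of `γ = (A B; C D) ∈ Sp₄(𝓞 F)` on the ambient space, componentwise through the real
embeddings: `(γ • Z)_σ = (A^σ Z_σ + B^σ)(C^σ Z_σ + D^σ)⁻¹` (`⁻¹` is `Matrix.inv`; on `ℍ` the
matrix `C^σ Z_σ + D^σ` is invertible [Andrianov2009, Lemma 1.3]; off `ℍ` the value is junk).
[cite: Andrianov2009, (1.6)] -/
noncomputable def moeb (γ : Sp4 (𝓞 F)) (Z : Point F) : Point F := fun σ =>
  (embMat σ (blockA γ) * Z σ + embMat σ (blockB γ)) * (embMat σ (blockC γ) * Z σ + embMat σ (blockD γ))⁻¹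

/-- The (scalar, parallel) automorphy factor `j(γ, Z) = ∏_σ det(C^σ Z_σ + D^σ)`; a form of parallel
weight `k` transforms with `j(γ, Z)^k`. [cite: Andrianov2009, (1.29)] -/
noncomputable def autFactor (γ : Sp4 (𝓞 F)) (Z : Point F) : ℂ :=
  ∏ σ, (embMat σ (blockC γ) * Z σ + embMat σ (blockD γ)).det

variable (F) in
/-- Holomorphy of `f` on the Hilbert–Siegel half space: `ℂ`-differentiability on the (open) set
`ℍ` of the function transported to the `Pi` normed space `(F →+* ℝ) → Fin 2 → Fin 2 → ℂ` along
`Matrix.of` (a function of `3·[F:ℚ]` complex variables; [Andrianov2009, §1.3 (i)]). [folklore] -/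
def IsHolomorphicOn (f : Point F → ℂ) : Prop :=
  DifferentiableOn ℂ (fun Z : (F →+* ℝ) → Fin 2 → Fin 2 → ℂ => f fun σ => Matrix.of (Z σ))
    {Z | (fun σ => Matrix.of (Z σ)) ∈ halfSpace F}

/-- Sums of holomorphic functions are holomorphic. [folklore] -/
theorem IsHolomorphicOn.add {f g : Point F → ℂ} (hf : IsHolomorphicOn F f)
    (hg : IsHolomorphicOn F g) : IsHolomorphicOn F (f + g) :=
  DifferentiableOn.add hf hg

/-- Scalar multiples of holomorphic functions are holomorphic. [folklore] -/
theorem IsHolomorphicOn.smul {f : Point F → ℂ} (c : ℂ) (hf : IsHolomorphicOn F f) :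
    IsHolomorphicOn F (c • f) :=
  DifferentiableOn.const_smul hf c

variable (F) in
omit [NumberField F] in
/-- The zero function is holomorphic. [folklore] -/
theorem IsHolomorphicOn.zero : IsHolomorphicOn F (0 : Point F → ℂ) :=
  differentiableOn_const 0

/-- **Hilbert–Siegel modular forms** of genus `2`, parallel weight `k`, level a subgroup
`Γ ≤ Sp₄(𝓞 F)` and character `χ : Γ →* ℂ`, as a predicate on functions `f` on the ambient space:
`f` is holomorphic on `ℍ`, satisfies `f(γ • Z) = χ(γ) · j(γ, Z)^k · f(Z)` for `γ ∈ Γ`, `Z ∈ ℍ`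
(Andrianov's `F|_k γ = χ(γ) F`, [Andrianov2009, §1.3 (1.32)] for `F = ℚ`; for totally real `F`
the same definition on `ℍ₂^{[F:ℚ]}` with `Sp₄(𝓞 F)` acting through the real embeddings,
[Sankaran2025, §2.1]), and — a normalisation of junk values — vanishes off `ℍ`. No condition at the
cusps (Koecher's principle in genus `2`, [vanderGeer2008, Thm. 2]). Typical use:
`Γ = Gamma0 𝔫`, `χ = Gamma0.character 𝔫 ψ`. [cite: Andrianov2009, §1.3 (1.32)] -/
structure IsModularForm (Γ : Subgroup (Sp4 (𝓞 F))) (χ : Γ →* ℂ) (k : ℕ) (f : Point F → ℂ) :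
    Prop where
  holomorphic : IsHolomorphicOn F f
  transform : ∀ γ : Γ, ∀ Z ∈ halfSpace F,
    f (moeb (γ : Sp4 (𝓞 F)) Z) = χ γ * autFactor (γ : Sp4 (𝓞 F)) Z ^ k * f Z
  eq_zero : ∀ Z ∉ halfSpace F, f Z = 0

/-- The `ℂ`-vector space `M_k(Γ, χ)` of Hilbert–Siegel modular forms of genus `2`, parallel weight
`k`, level `Γ ≤ Sp₄(𝓞 F)` and character `χ`, as a submodule of all functions on the ambient space.
[cite: Andrianov2009, §1.3] -/
def modularForms (Γ : Subgroup (Sp4 (𝓞 F))) (χ : Γ →* ℂ) (k : ℕ) : Submodule ℂ (Point F → ℂ) where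
  carrier := {f | IsModularForm Γ χ k f}
  zero_mem' := ⟨IsHolomorphicOn.zero F, fun γ Z _ => by simp, fun Z _ => rfl⟩
  add_mem' {f g} hf hg :=
    ⟨hf.holomorphic.add hg.holomorphic, fun γ Z hZ => by
      rw [Pi.add_apply, Pi.add_apply, hf.transform γ Z hZ, hg.transform γ Z hZ]; ring,
      fun Z hZ => by rw [Pi.add_apply, hf.eq_zero Z hZ, hg.eq_zero Z hZ, add_zero]⟩
  smul_mem' c f hf :=
    ⟨hf.holomorphic.smul c, fun γ Z hZ => by
      rw [Pi.smul_apply, Pi.smul_apply, smul_eq_mul, smul_eq_mul, hf.transform γ Z hZ]; ring,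
      fun Z hZ => by rw [Pi.smul_apply, smul_eq_mul, hf.eq_zero Z hZ, mul_zero]⟩

/-- Membership in `M_k(Γ, χ)` is the predicate `IsModularForm`. [cite: Andrianov2009, §1.3] -/
theorem mem_modularForms_iff {Γ : Subgroup (Sp4 (𝓞 F))} {χ : Γ →* ℂ} {k : ℕ} {f : Point F → ℂ} :
    f ∈ modularForms Γ χ k ↔ IsModularForm Γ χ k f :=
  Iff.rfl

/-! ## §3 `q`-expansions -/

variable (F) in
/-- The index set of genus-`2` `q`-expansions over `F`: symmetric `T ∈ M₂(F)` which pair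
integrally with the translation lattice `Sym₂(𝓞 F)` under `(T, S) ↦ Tr_{F/ℚ}(tr(T S))`
(equivalently `t₁₁, t₂₂, 2t₁₂ ∈ 𝔡⁻¹`, the inverse different; for `F = ℚ`: `T` half-integral,
[vanderGeer2008, Def. 3]) and are totally positive semi-definite (`σ(T) ≥ 0` for every real `σ`;
by Koecher's principle [vanderGeer2008, Thm. 2] only these carry Fourier coefficients).
[cite: vanderGeer2008, §4] -/
def qIndexSet : Set (Matrix (Fin 2) (Fin 2) F) :=
  {T | T.IsSymm ∧
    (∀ S : Matrix (Fin 2) (Fin 2) (𝓞 F), S.IsSymm →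
      ∃ n : ℤ, Algebra.trace ℚ F (T * S.map (algebraMap (𝓞 F) F)).trace = n) ∧
    ∀ σ : F →+* ℝ, (T.map σ).PosSemidef}

/-- Membership in the `q`-expansion index set. [cite: vanderGeer2008, §4] -/
theorem mem_qIndexSet_iff {T : Matrix (Fin 2) (Fin 2) F} :
    T ∈ qIndexSet F ↔ T.IsSymm ∧
      (∀ S : Matrix (Fin 2) (Fin 2) (𝓞 F), S.IsSymm →
        ∃ n : ℤ, Algebra.trace ℚ F (T * S.map (algebraMap (𝓞 F) F)).trace = n) ∧
      ∀ σ : F →+* ℝ, (T.map σ).PosSemidef :=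
  Iff.rfl

variable (F) in
/-- Real coordinates on `Sym₂(F ⊗ ℝ)`: three slots (entries `(1,1)`, `(1,2) = (2,1)`, `(2,2)`),
each with one real coordinate per element of the integral basis of `𝓞 F`. [folklore] -/
abbrev Coord : Type _ := Fin 3 → Module.Free.ChooseBasisIndex ℤ (𝓞 F) → ℝ

/-- The real symmetric matrix `X(x)_σ` with entries `u_s = ∑_i x_{s,i} σ(b_i)`, `b` the integral
basis of `𝓞 F`; as `x` ranges over the unit cube, `X(x)` ranges over a fundamental parallelotope of
the lattice `Sym₂(𝓞 F) ⊆ Sym₂(F ⊗ ℝ)`. [folklore] -/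
noncomputable def realPart (x : Coord F) (σ : F →+* ℝ) : Matrix (Fin 2) (Fin 2) ℝ :=
  let u : Fin 3 → ℝ := fun s => ∑ i, x s i * σ (integralBasis F i)
  !![u 0, u 1; u 1, u 2]

/-- The point `X(x) + i·1 ∈ ℍ` of the Hilbert–Siegel half space with real part `X(x)` and
imaginary part the identity at every embedding. [folklore] -/
noncomputable def cubePoint (x : Coord F) : Point F := fun σ =>
  (realPart x σ).map Complex.ofReal + Complex.I • (1 : Matrix (Fin 2) (Fin 2) ℂ)

/-- The pairing `⟨T, Z⟩ = ∑_σ tr(σ(T) Z_σ)` (so that `q^T = e^{2πi⟨T,Z⟩}`, Sankaran's `e(τT)`).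
[cite: Sankaran2025, §2.1] -/
noncomputable def pairing (T : Matrix (Fin 2) (Fin 2) F) (Z : Point F) : ℂ :=
  ∑ σ : F →+* ℝ, (T.map (fun a => ((σ a : ℝ) : ℂ)) * Z σ).trace

/-- The `T`-th Fourier coefficient of a `Sym₂(𝓞 F)`-periodic function `f` on `ℍ`:
`a(T) = ∫_{[0,1]^{3[F:ℚ]}} f(X(x) + i·1) e^{-2πi⟨T, X(x) + i·1⟩} dx` (van der Geer's
`a(n) = ∫_{x mod 1} f(τ) e^{-2πi Tr(nτ)} dx`, taken at `y = 1`, in integral-basis coordinates, so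
that `f(Z) = ∑_T a(T) e^{2πi⟨T, Z⟩}`). Periodicity holds for `f ∈ M_k(Γ, χ)` whenever `Γ` contains
the translations `(1 S; 0 1)`, `S ∈ Sym₂(𝓞 F)`, and `χ` is trivial on them (e.g. `Γ = Gamma0 𝔫`,
`χ = Gamma0.character 𝔫 ψ`); for other `f` the value is junk. [cite: vanderGeer2008, §4] -/
noncomputable def fourierCoeff (f : Point F → ℂ) (T : Matrix (Fin 2) (Fin 2) F) : ℂ :=
  ∫ x in Set.Icc (0 : Coord F) 1,
    f (cubePoint x) * Complex.exp (-(2 * Real.pi * Complex.I * pairing T (cubePoint x)))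

/-- The `q`-expansion `T ↦ a(T)` of `f`, as a function on all of `M₂(F)` extended by `0` off the
index set `qIndexSet F` (formal series `∑_{T ∈ qIndexSet F} a(T) q^T`). [cite: vanderGeer2008, §4] -/
noncomputable def qExpansion (f : Point F → ℂ) : Matrix (Fin 2) (Fin 2) F → ℂ :=
  (qIndexSet F).indicator (fourierCoeff f)

/-- On the index set the `q`-expansion is the Fourier coefficient. [folklore] -/
theorem qExpansion_of_mem {f : Point F → ℂ} {T : Matrix (Fin 2) (Fin 2) F} (hT : T ∈ qIndexSet F) :
    qExpansion f T = fourierCoeff f T :=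
  Set.indicator_of_mem hT _

/-- Off the index set the `q`-expansion vanishes (by definition). [folklore] -/
theorem qExpansion_of_not_mem {f : Point F → ℂ} {T : Matrix (Fin 2) (Fin 2) F}
    (hT : T ∉ qIndexSet F) : qExpansion f T = 0 :=
  Set.indicator_of_notMem hT _

/-! ## §4 Formal `q`-series with coefficients in `R` and mod-`N` forms -/

section ModN

variable (F)
variable (R : Type*) [CommRing R]

/-- Formal genus-`2` `q`-series over `F` with coefficients in `R`: functions `M₂(F) → R` supported
on the index set `qIndexSet F` (the `R`-module `∏_{T ∈ qIndexSet F} R · q^T`). [folklore] -/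
def qSeries : Submodule R (Matrix (Fin 2) (Fin 2) F → R) where
  carrier := {a | ∀ T ∉ qIndexSet F, a T = 0}
  zero_mem' _ _ := rfl
  add_mem' ha hb T hT := by rw [Pi.add_apply, ha T hT, hb T hT, add_zero]
  smul_mem' c a ha T hT := by rw [Pi.smul_apply, ha T hT, smul_zero]

variable {F R}

/-- Membership in `qSeries`: support in the index set. [folklore] -/
theorem mem_qSeries_iff {a : Matrix (Fin 2) (Fin 2) F → R} :
    a ∈ qSeries F R ↔ ∀ T ∉ qIndexSet F, a T = 0 :=
  Iff.rfl

/-- `q`-expansions are formal `q`-series. [folklore] -/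
theorem qExpansion_mem_qSeries (f : Point F → ℂ) : qExpansion f ∈ qSeries F ℂ :=
  fun _ hT => qExpansion_of_not_mem hT

/-- The integral `q`-expansions of level `Γ`, character `χ`, weight `k`: functions
`a : M₂(F) → ℤ` such that `a` (cast to `ℂ`) is the `q`-expansion of some `f ∈ M_k(Γ, χ)` — the
lattice `M_k(Γ, χ; ℤ)` of forms with integer Fourier coefficients, seen in `ℤ⟦q⟧`.
[cite: FaltingsChai1990, Ch. V] -/
def integralQExpansions (Γ : Subgroup (Sp4 (𝓞 F))) (χ : Γ →* ℂ) (k : ℕ) :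
    Set (Matrix (Fin 2) (Fin 2) F → ℤ) :=
  {a | ∃ f ∈ modularForms Γ χ k, ∀ T, qExpansion f T = (a T : ℂ)}

/-- Unfolding of `integralQExpansions`. [cite: FaltingsChai1990, Ch. V] -/
theorem mem_integralQExpansions_iff {Γ : Subgroup (Sp4 (𝓞 F))} {χ : Γ →* ℂ} {k : ℕ}
    {a : Matrix (Fin 2) (Fin 2) F → ℤ} :
    a ∈ integralQExpansions Γ χ k ↔ ∃ f ∈ modularForms Γ χ k, ∀ T, qExpansion f T = (a T : ℂ) :=
  Iff.rfl

/-- Integral `q`-expansions are supported on the index set. [folklore] -/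
theorem apply_eq_zero_of_mem_integralQExpansions {Γ : Subgroup (Sp4 (𝓞 F))} {χ : Γ →* ℂ} {k : ℕ}
    {a : Matrix (Fin 2) (Fin 2) F → ℤ} (ha : a ∈ integralQExpansions Γ χ k)
    {T : Matrix (Fin 2) (Fin 2) F} (hT : T ∉ qIndexSet F) : a T = 0 := by
  obtain ⟨f, -, hf⟩ := ha
  have h := hf T
  rw [qExpansion_of_not_mem hT] at h
  exact_mod_cast h.symm

end ModN

end HilbertSiegel

section Main

open HilbertSiegel

variable {F : Type*} [Field F] [NumberField F]

/-- **`R`-valued (mod `N`) Hilbert–Siegel modular forms of genus `2`** of level `Γ ≤ Sp₄(𝓞 F)`,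
character `χ` and parallel weight `k`, defined algebraically through `q`-expansions: the
`R`-submodule of formal `q`-series `M₂(F) → R` spanned by the coefficientwise images
`T ↦ (a(T) : R)` of the integral `q`-expansions `a ∈ M_k(Γ, χ; ℤ)`
(`HilbertSiegel.integralQExpansions`), i.e. the image of `M_k(Γ, χ; ℤ) ⊗_ℤ R → R⟦q⟧`. For
`R = ℤ/N` these are exactly the reductions mod `N` of (`ℤ`-linear combinations of) forms with
integral Fourier coefficients. (This is the `q`-expansion-theoretic integral structure of
[FaltingsChai1990, Ch. V]; it need not coincide with `H⁰(𝒜 ⊗ R, ω^k)` in low weight.) Typical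
use: `Γ = Gamma0 𝔫`, `χ = Gamma0.character 𝔫 ψ`, `k = 2`, `R = ZMod N`.
[cite: FaltingsChai1990, Ch. V] -/
def hilbertSiegelModularFormModN (Γ : Subgroup (Sp4 (𝓞 F))) (χ : Γ →* ℂ) (k : ℕ)
    (R : Type*) [CommRing R] : Submodule R (Matrix (Fin 2) (Fin 2) F → R) :=
  Submodule.span R ((fun (a : Matrix (Fin 2) (Fin 2) F → ℤ) (T : Matrix (Fin 2) (Fin 2) F) =>
    (a T : R)) '' integralQExpansions Γ χ k)

/-- The TYPE of `R`-valued (mod `N`) Hilbert–Siegel modular forms of genus `2`, level `Γ`,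
character `χ`, parallel weight `k`: the elements of the submodule
`hilbertSiegelModularFormModN Γ χ k R` of formal `q`-series `M₂(F) → R` (coercion to functions
available). [cite: FaltingsChai1990, Ch. V] -/
abbrev HilbertSiegelModularFormModN (Γ : Subgroup (Sp4 (𝓞 F))) (χ : Γ →* ℂ) (k : ℕ)
    (R : Type*) [CommRing R] : Type _ :=
  ↥(hilbertSiegelModularFormModN Γ χ k R)

/-- The image in `R⟦q⟧` of an integral `q`-expansion is a mod-`N` form. [folklore] -/
theorem intCast_comp_mem_hilbertSiegelModularFormModN {Γ : Subgroup (Sp4 (𝓞 F))} {χ : Γ →* ℂ}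
    {k : ℕ} (R : Type*) [CommRing R] {a : Matrix (Fin 2) (Fin 2) F → ℤ}
    (ha : a ∈ integralQExpansions Γ χ k) :
    (fun T => (a T : R)) ∈ hilbertSiegelModularFormModN Γ χ k R :=
  Submodule.subset_span ⟨a, ha, rfl⟩

/-- Mod-`N` forms are formal `q`-series: they are supported on the index set. [folklore] -/
theorem hilbertSiegelModularFormModN_le_qSeries (Γ : Subgroup (Sp4 (𝓞 F))) (χ : Γ →* ℂ) (k : ℕ)
    (R : Type*) [CommRing R] : hilbertSiegelModularFormModN Γ χ k R ≤ qSeries F R := by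
  refine Submodule.span_le.2 ?_
  rintro _ ⟨a, ha, rfl⟩ T hT
  simp [apply_eq_zero_of_mem_integralQExpansions ha hT]

/-- Base change: a ring homomorphism `g : R →+* R'` maps mod-`N` forms over `R` to mod-`N` forms
over `R'` coefficientwise. [folklore] -/
theorem comp_mem_hilbertSiegelModularFormModN {Γ : Subgroup (Sp4 (𝓞 F))} {χ : Γ →* ℂ} {k : ℕ}
    {R R' : Type*} [CommRing R] [CommRing R'] (g : R →+* R') {a : Matrix (Fin 2) (Fin 2) F → R}
    (ha : a ∈ hilbertSiegelModularFormModN Γ χ k R) :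
    (fun T => g (a T)) ∈ hilbertSiegelModularFormModN Γ χ k R' := by
  induction ha using Submodule.span_induction with
  | mem x hx =>
    obtain ⟨b, hb, rfl⟩ := hx
    have h : (fun T => g ((fun T => (b T : R)) T)) = fun T => (b T : R') := by
      funext T; simp
    rw [h]
    exact intCast_comp_mem_hilbertSiegelModularFormModN R' hb
  | zero =>
    have h : (fun T => g ((0 : Matrix (Fin 2) (Fin 2) F → R) T)) = 0 := by
      funext T; simp
    rw [h]
    exact Submodule.zero_mem _
  | add x y _ _ hx hy =>
    have h : (fun T => g ((x + y) T)) = (fun T => g (x T)) + fun T => g (y T) := by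
      funext T; simp
    rw [h]
    exact Submodule.add_mem _ hx hy
  | smul c x _ hx =>
    have h : (fun T => g ((c • x) T)) = g c • fun T => g (x T) := by
      funext T; simp
    rw [h]
    exact Submodule.smul_mem _ (g c) hx

end Main

/-! ## §5 Hecke operators `T(ϖ)` on formal `q`-series -/

namespace HilbertSiegel

variable {F : Type*} [Field F] [NumberField F]
variable (R : Type*) [CommRing R]

variable (F) in
/-- Extension by zero / restriction to the index set, as an `R`-linear endomorphism of functions
`M₂(F) → R`; its image is `qSeries F R`. [folklore] -/
noncomputable def restrictIndex : (Matrix (Fin 2) (Fin 2) F → R) →ₗ[R] (Matrix (Fin 2) (Fin 2) F → R)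
    where
  toFun a := (qIndexSet F).indicator a
  map_add' a b := by
    funext T; by_cases hT : T ∈ qIndexSet F <;> simp [hT]
  map_smul' c a := by
    funext T; by_cases hT : T ∈ qIndexSet F <;> simp [hT]

variable {R}

/-- Unfolding of `restrictIndex`. [folklore] -/
@[simp] theorem restrictIndex_apply (a : Matrix (Fin 2) (Fin 2) F → R) (T : Matrix (Fin 2) (Fin 2) F) :
    restrictIndex F R a T = (qIndexSet F).indicator a T := rfl

/-- `restrictIndex` lands in formal `q`-series. [folklore] -/
theorem restrictIndex_mem_qSeries (a : Matrix (Fin 2) (Fin 2) F → R) : restrictIndex F R a ∈ qSeries F R :=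
  fun _ hT => Set.indicator_of_notMem hT _

/-- The matrix `D_∞(ϖ) = (ϖ 0; 0 1)`, the last left-coset representative of
`SL₂ \ SL₂ diag(1, ϖ) SL₂`. [cite: Andrianov2009, Ex. 3.19] -/
def heckeMatInf (ϖ : 𝓞 F) : Matrix (Fin 2) (Fin 2) F := !![(ϖ : F), 0; 0, 1]

/-- The matrices `D_j(ϖ) = (1 j; 0 ϖ)`, `j` running over a transversal of `𝓞 F ⧸ (ϖ)`, the other
left-coset representatives of `SL₂ \ SL₂ diag(1, ϖ) SL₂`. [cite: Andrianov2009, Ex. 3.19] -/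
def heckeMatFin (ϖ j : 𝓞 F) : Matrix (Fin 2) (Fin 2) F := !![1, (j : F); 0, (ϖ : F)]

/-- The absolute norm `q = N(ϖ) = #(𝓞 F ⧸ (ϖ))` (`0` if `ϖ = 0`). [folklore] -/
noncomputable def normGen (ϖ : 𝓞 F) : ℕ := Ideal.absNorm (Ideal.span ({ϖ} : Set (𝓞 F)))

/-- The raw Hecke sum at the generator `ϖ`, weight `k`, character value `c = χ(ϖ)`, with an explicit
finite set `reps ⊆ 𝓞 F` of representatives of `𝓞 F ⧸ (ϖ)`:
`a ↦ (T ↦ a(ϖT) + c q^{k-2} (a(ϖ⁻¹ D_∞ T D_∞ᵀ) + ∑_{j ∈ reps} a(ϖ⁻¹ D_j T D_jᵀ)) + c² q^{2k-3} a(ϖ⁻¹T))`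
(before restriction to the index set). [cite: Andrianov2009, Prop. 5.16] -/
noncomputable def heckeSum (reps : Finset (𝓞 F)) (ϖ : 𝓞 F) (k : ℕ) (c : R) :
    (Matrix (Fin 2) (Fin 2) F → R) →ₗ[R] (Matrix (Fin 2) (Fin 2) F → R) where
  toFun a T :=
    a ((ϖ : F) • T)
      + c * (normGen ϖ : R) ^ (k - 2) *
          (a ((ϖ : F)⁻¹ • (heckeMatInf ϖ * T * (heckeMatInf ϖ)ᵀ))
            + ∑ j ∈ reps, a ((ϖ : F)⁻¹ • (heckeMatFin ϖ j * T * (heckeMatFin ϖ j)ᵀ)))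
      + c ^ 2 * (normGen ϖ : R) ^ (2 * k - 3) * a ((ϖ : F)⁻¹ • T)
  map_add' a b := by
    funext T
    simp only [Pi.add_apply, Finset.sum_add_distrib]
    ring
  map_smul' r a := by
    funext T
    simp only [Pi.smul_apply, smul_eq_mul, RingHom.id_apply]
    rw [← Finset.mul_sum]
    ring

/-- The **Hecke operator `T(ϖ)` on formal `q`-series** of parallel weight `k` with character value
`c = χ(ϖ)`, for a chosen transversal `reps` of `𝓞 F ⧸ (ϖ)`:
`(T(ϖ)a)(T) = a(ϖT) + c·q^{k-2} ∑_{D ∈ 𝓓(ϖ)} a(ϖ⁻¹ D T Dᵀ) + c²·q^{2k-3} a(ϖ⁻¹ T)` for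
`T ∈ qIndexSet F` (and `0` otherwise), where `q = N(ϖ)`,
`𝓓(ϖ) = {(1 j; 0 ϖ) : j ∈ reps} ∪ {(ϖ 0; 0 1)}` and `a` is evaluated as `0` off the index set when
`a ∈ qSeries F R`. For `F = ℚ`, `ϖ = p ∤ level`, `reps = {0,…,p-1}` this is the classical action of
`T(p)` on Fourier coefficients of `M_k(Γ₀²(N), χ)` [Andrianov2009, Prop. 5.16, (5.29) with
`m = p`; in the language of even matrices `A = 2T`]; for general totally real `F` and a totally
positive generator `ϖ` of a prime `(ϖ) ∤ 𝔫` it is the same left-coset computation for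
`Γ₀(𝔫) diag(1,1,ϖ,ϖ) Γ₀(𝔫)` with the normalisation `μ^{2k-3}` of [Andrianov2009, (1.29)].
Intended for `k ≥ 2` (for `k < 2` the exponents are truncated ℕ-subtractions). [cite: Andrianov2009, Prop. 5.16] -/
noncomputable def heckeTWith (reps : Finset (𝓞 F)) (ϖ : 𝓞 F) (k : ℕ) (c : R) :
    (Matrix (Fin 2) (Fin 2) F → R) →ₗ[R] (Matrix (Fin 2) (Fin 2) F → R) :=
  (restrictIndex F R).comp (heckeSum reps ϖ k c)

open scoped Classical in
/-- A transversal of `𝓞 F ⧸ (ϖ)` in `𝓞 F` chosen once and for all (empty if `ϖ = 0`). [folklore] -/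
noncomputable def transversal (ϖ : 𝓞 F) : Finset (𝓞 F) :=
  if h : ϖ = 0 then ∅
  else
    haveI : Finite (𝓞 F ⧸ Ideal.span ({ϖ} : Set (𝓞 F))) :=
      Ideal.finiteQuotientOfFreeOfNeBot _ (by simpa [Ideal.span_singleton_eq_bot] using h)
    (Set.finite_range
      (Function.surjInv (Ideal.Quotient.mk_surjective (I := Ideal.span ({ϖ} : Set (𝓞 F)))))).toFinset

/-- **The Hecke operator `T(ϖ)`** on formal genus-`2` `q`-series over `F` with coefficients in `R`,
parallel weight `k`, character value `c = χ(ϖ)`, at a generator `ϖ` (intended: `ϖ ≫ 0` generating a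
prime ideal not dividing the level), with the transversal `transversal ϖ` of `𝓞 F ⧸ (ϖ)`:
see `heckeTWith`. [cite: Andrianov2009, Prop. 5.16] -/
noncomputable def heckeT (ϖ : 𝓞 F) (k : ℕ) (c : R) :
    (Matrix (Fin 2) (Fin 2) F → R) →ₗ[R] (Matrix (Fin 2) (Fin 2) F → R) :=
  heckeTWith (transversal ϖ) ϖ k c

/-- The Hecke operator on the index set: Andrianov's formula (5.29) at `m = p`, transcribed.
[cite: Andrianov2009, Prop. 5.16] -/
theorem heckeTWith_apply_of_mem (reps : Finset (𝓞 F)) (ϖ : 𝓞 F) (k : ℕ) (c : R)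
    (a : Matrix (Fin 2) (Fin 2) F → R) {T : Matrix (Fin 2) (Fin 2) F} (hT : T ∈ qIndexSet F) :
    heckeTWith reps ϖ k c a T =
      a ((ϖ : F) • T)
        + c * (normGen ϖ : R) ^ (k - 2) *
            (a ((ϖ : F)⁻¹ • (heckeMatInf ϖ * T * (heckeMatInf ϖ)ᵀ))
              + ∑ j ∈ reps, a ((ϖ : F)⁻¹ • (heckeMatFin ϖ j * T * (heckeMatFin ϖ j)ᵀ)))
        + c ^ 2 * (normGen ϖ : R) ^ (2 * k - 3) * a ((ϖ : F)⁻¹ • T) := by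
  simp [heckeTWith, heckeSum, Set.indicator_of_mem hT]

/-- The Hecke operator vanishes off the index set (by definition). [folklore] -/
theorem heckeTWith_apply_of_not_mem (reps : Finset (𝓞 F)) (ϖ : 𝓞 F) (k : ℕ) (c : R)
    (a : Matrix (Fin 2) (Fin 2) F → R) {T : Matrix (Fin 2) (Fin 2) F} (hT : T ∉ qIndexSet F) :
    heckeTWith reps ϖ k c a T = 0 := by
  simp [heckeTWith, Set.indicator_of_notMem hT]

/-- Hecke operators preserve formal `q`-series (indeed land in them). [folklore] -/
theorem heckeTWith_mem_qSeries (reps : Finset (𝓞 F)) (ϖ : 𝓞 F) (k : ℕ) (c : R)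
    (a : Matrix (Fin 2) (Fin 2) F → R) : heckeTWith reps ϖ k c a ∈ qSeries F R :=
  fun _ hT => heckeTWith_apply_of_not_mem reps ϖ k c a hT

/-- `heckeT` lands in formal `q`-series. [folklore] -/
theorem heckeT_mem_qSeries (ϖ : 𝓞 F) (k : ℕ) (c : R) (a : Matrix (Fin 2) (Fin 2) F → R) :
    heckeT ϖ k c a ∈ qSeries F R :=
  heckeTWith_mem_qSeries _ ϖ k c a

/-- In weight `2` with trivial character value the formula reads
`(T(ϖ)a)(T) = a(ϖT) + ∑_{D ∈ 𝓓(ϖ)} a(ϖ⁻¹ D T Dᵀ) + q · a(ϖ⁻¹ T)` — the case used for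
class-number/theta series of weight `2`. [cite: Andrianov2009, Prop. 5.16] -/
theorem heckeTWith_two_one_apply (reps : Finset (𝓞 F)) (ϖ : 𝓞 F)
    (a : Matrix (Fin 2) (Fin 2) F → R) {T : Matrix (Fin 2) (Fin 2) F} (hT : T ∈ qIndexSet F) :
    heckeTWith reps ϖ 2 (1 : R) a T =
      a ((ϖ : F) • T)
        + (a ((ϖ : F)⁻¹ • (heckeMatInf ϖ * T * (heckeMatInf ϖ)ᵀ))
            + ∑ j ∈ reps, a ((ϖ : F)⁻¹ • (heckeMatFin ϖ j * T * (heckeMatFin ϖ j)ᵀ)))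
        + (normGen ϖ : R) * a ((ϖ : F)⁻¹ • T) := by
  rw [heckeTWith_apply_of_mem reps ϖ 2 1 a hT]
  simp

end HilbertSiegel

end Literature.NumberTheory.Automorphic
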